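/-
Copyright (c) 2026 the pub-hodgecm-mathlib formalisation cell (harness21).  Prover seat hodgecm-mathlib-K2Liu-p01 (g6), Track B «K2-LIT»,
Road I organ (A-int)-fin, A2d «geometric actions junction» (LEAD F0P6-plan (g12) 08:00:40Z; census 08:03Z, heads 08:05Z on K2/STATUS).  KERNEL: theorems only.
-/
import Summits.HodgeConjecture.HodgeConjecture.Theorems.K2LiuKudlaRallisMapDeltaModel        -- ★ A2c p858455 (pins; brings A2a, β-1, β-3, `leviSp`, `MpPsi.toRep`)
import Literature.NumberTheory.GelbartRogawski1991.LocalDoubledSiegelUnipotentMover          -- ★ `iotaD_apply_of_mem_deltaLagrangian`, `iotaD_apply_sub_mem_deltaLagrangian`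
import Literature.NumberTheory.GelbartRogawski1991.LocalDoubledUnitarySiegel                 -- ★ `isSiegelDelta_iff_map_le`
import Summits.HodgeConjecture.HodgeConjecture.Theorems.K2LiuDoublingEigenfunctionalNonvanishing   -- ★ `deltaW_mem_deltaLagrangian` (K2Liu-p01 (g4))
import HarnessLib

/-!
# Crux `HLiu418`, Track B road `K2_Liu`, Road I organ (A-int)-fin — A2d: THE SIEGEL LETTERS IN THE `ℓ_Δ`-ADAPTED SYMPLECTIC COORDINATES
# (`deltaCoords ∘ ι(h) ∘ deltaCoords⁻¹ = m(a,d) · n(b)` for `h ∈ P_Δ`; `= n(b)` for the Siegel unipotents) and the junction with the Weil operators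

Cell `hodgecm-mathlib`, crux item hLiu418 = `stmt-HodgeConjecture-24832`, route of record `HCCMUnconditional`; squad K2 ∕ K2Liu, prover K2Liu-p01 (g6).
THEOREMS ONLY (no `def`, no instance, no notation, no named fact, no `sorry`); lane `--supports stmt-HodgeConjecture-24832 --as helper`.

The doubling-polarised model of ★ β-1 reads the symplectic group through ★ `deltaSymplecticTransport` = conjugation by ★ `deltaCoords`
(`𝕎_v ≃ X_Δ × Y_Δ`, `X_Δ ↔ ℓ_∇`, `Y_Δ ↔ ℓ_Δ`).  The unitary group `U(𝔻)(F_v)` enters through GR91's ★ `iotaD` (CM coordinates), and its Siegel parabolic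
`P_Δ` is ★ `IsSiegelDelta h :⇔ ι(h) ℓ_Δ = ℓ_Δ`.  This file identifies the images of the Siegel letters as Weil's letters of ★ `SchrodingerSymplecticGenerators`:

* §1 (any field with `⅟2`, Gram pairing `β_T`, `det T` a unit) **`exists_eq_leviSp_mul_unipotentSp`** — an element of `Sp(polar β_T)` PRESERVING THE MODULATION
  LAGRANGIAN `0 × Y` is `m(a, d) · n(b)` with `a x = (g(x,0)).1`, `d y = (g(0,y)).2`, `d (b x) = (g(x,0)).2` (the Sp-half of ★ `exists_blockImplementer`, model-free);
  pure cases `exists_eq_unipotentSp`, `exists_eq_leviSp`.  [Weil1964, n° 6: `P(X) = d₀(GL) ⋉ t₀(Sym)`.]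
* §2 **`mem_deltaLagrangian_iff_fst_deltaCoords`** — `ℓ_Δ = deltaCoords⁻¹(0 × Y_Δ)` (★ `deltaCoords_deltaW`), `deltaCoords_symm_inr`.
* §3 THE LETTERS (GR91's generic local doubled datum `(F, E, c, δ, v, n, T₀)`, `σ′ := deltaSymplecticTransport e₂ T₀,v (localGram_gramD) (iotaD h)`):
  **(P) `fst_deltaTransport_iotaD_inr` — `IsSiegelDelta h ⇒ (σ′ (0, y)).1 = 0`**, hence **`exists_deltaTransport_iotaD_eq_leviSp_mul_unipotentSp`**;
  **(N) `exists_deltaTransport_iotaD_eq_unipotentSp`** — an adapted Siegel unipotent (`adapt (matA u) = (1, t; 0, 1)`: ★ mover lemmas «fixes ℓ_Δ pointwise»,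
  «trivial mod ℓ_Δ») goes to a PURE `n(b)`.
* SEQUEL `K2LiuDeltaSpTransportSiegelJunction` (§4): the junction with the Weil operators in (β-1)'s names — `toRep (sΔ h) = c • (leviEquivSB a ∘ unipotentEquivSB q_b)`
  for `h ∈ P_Δ`, `= c • unipotentEquivSB q_b` for adapted Siegel unipotents (★ A2c, implementer uniqueness).
NOT here (A2d-2): the master block formula `σ′ (X b, Y a) = (X(D b + C a), Y(B b + A a))` in the adapted blocks of ★ `DoubledUnitaryAdaptedBlocks` (⇒ the Levi letter
with explicit `a = X D X⁻¹`, the `1 ⊗ g` letter of `U(V′_w)`), and the Weyl letter (★ `iotaD_weylDelta_eq_transportSp_levi` + B1b).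

HONEST LABEL: HC_CM is proved only modulo the printed citations (2 remaining named inputs: hLiu418 = stmt-HodgeConjecture-24832, h413 = stmt-HodgeConjecture-24833)
until rung 0 closes; helper, closes no item.
References: [Weil1964] n° 5–6 (the parabolic `P(X)`), n° 13; [Kudla1994] §2–§3 (doubled space, `P_Δ`, Thm. 3.1); [HarrisKudlaSweet1996] §1 (1.11)–(1.15);
[MoeglinVignerasWaldspurger1987] Chap. 2 I.7, II.1, II.6; [GanQiuTakeda2014] §2.8.
-/

set_option autoImplicit false
set_option linter.dupNamespace false -- the mandated namespace repeats `HodgeConjecture.HodgeConjecture`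

noncomputable section

open Matrix Topology
open scoped NNReal
open NumberField IsDedekindDomain
open Literature.NumberTheory.Automorphic Literature.NumberTheory.Automorphic.UnitaryGroup
open Literature.RepresentationTheory.HeisenbergGroup
open Literature.NumberTheory.GelbartRogawski1991 Literature.NumberTheory.GelbartRogawski1991.AdaptedBlocks
open Literature.NumberTheory.GelbartRogawski1991.UnitaryDualPair.LocalSplitting

namespace Summit.HodgeConjecture.HodgeConjecture.Cruxes.HLiu418.K2LiuDeltaSpTransportSiegelLetters

universe u

/-! ## §1 Elements of `Sp(polar β_T)` preserving the modulation Lagrangian `0 × Y` are `m(a,d) · n(b)` -/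

section SpDecomposition

variable {K : Type u} [Field K] [Invertible (2 : K)] {ι : Type*} [Fintype ι] [DecidableEq ι] (T : Matrix ι ι K) (hT : IsUnit T.det)

omit [Invertible (2 : K)] in
include hT in
/-- left separation of `β_T(x, y) = ⟨x, T y⟩` (`T` invertible). [folklore] -/
theorem eq_zero_of_forall_left {x : ι → K} (h : ∀ y : ι → K, Matrix.toLinearMap₂' K T x y = 0) : x = 0 := by
  funext i
  have h1 := h (T⁻¹ *ᵥ Pi.single i 1)
  rw [Matrix.toLinearMap₂'_apply', Matrix.mulVec_mulVec, Matrix.mul_nonsing_inv _ hT, Matrix.one_mulVec, dotProduct_single, mul_one] at h1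
  exact h1

omit [Invertible (2 : K)] in
include hT in
/-- right separation of `β_T`. [folklore] -/
theorem eq_zero_of_forall_right {y : ι → K} (h : ∀ x : ι → K, Matrix.toLinearMap₂' K T x y = 0) : y = 0 := by
  have hTy : T *ᵥ y = 0 := by
    funext i
    have h1 := h (Pi.single i 1)
    rw [Matrix.toLinearMap₂'_apply', single_dotProduct, one_mul] at h1
    exact h1
  have h2 : T⁻¹ *ᵥ (T *ᵥ y) = y := by rw [Matrix.mulVec_mulVec, Matrix.nonsing_inv_mul _ hT, Matrix.one_mulVec]
  rw [← h2, hTy, Matrix.mulVec_zero]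

include hT in
/-- **`Stab_{Sp}(0 × Y) = m(GL) ⋉ n(Sym)`**: an element `g ∈ Sp(polar β_T)` with `(g(0,y)).1 = 0` for all `y` is `g = leviSp a d · unipotentSp b` where
`a x = (g(x,0)).1`, `d y = (g(0,y)).2` (so `β(ax, dy) = β(x,y)`) and `d (b x) = (g(x,0)).2` (`b` symmetric for `β`) — Weil's structure of the parabolic `P(X)`,
the Sp-half of ★ `exists_blockImplementer`, for a Gram pairing. [cite: Weil1964, n° 6, p. 151] [cite: MoeglinVignerasWaldspurger1987, Chap. 2 II.6] -/
theorem exists_eq_leviSp_mul_unipotentSp (g : symplecticGroup (polar (Matrix.toLinearMap₂' K T)))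
    (hg : ∀ y : ι → K, ((g : ((ι → K) × (ι → K)) ≃ₗ[K] ((ι → K) × (ι → K))) (0, y)).1 = 0) :
    ∃ (a d : (ι → K) ≃ₗ[K] (ι → K)) (had : ∀ x y : ι → K, Matrix.toLinearMap₂' K T (a x) (d y) = Matrix.toLinearMap₂' K T x y)
      (b : (ι → K) →ₗ[K] (ι → K)) (hb : ∀ x x' : ι → K, Matrix.toLinearMap₂' K T x (b x') = Matrix.toLinearMap₂' K T x' (b x)),
      g = leviSp _ a d had * unipotentSp _ b hb ∧
        (∀ x, ((g : ((ι → K) × (ι → K)) ≃ₗ[K] ((ι → K) × (ι → K))) (x, 0)).1 = a x) ∧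
        (∀ y, ((g : ((ι → K) × (ι → K)) ≃ₗ[K] ((ι → K) × (ι → K))) (0, y)).2 = d y) ∧
        (∀ x, ((g : ((ι → K) × (ι → K)) ≃ₗ[K] ((ι → K) × (ι → K))) (x, 0)).2 = d (b x)) := by
  set G : ((ι → K) × (ι → K)) ≃ₗ[K] ((ι → K) × (ι → K)) := (g : ((ι → K) × (ι → K)) ≃ₗ[K] ((ι → K) × (ι → K))) with hG
  -- symplecticity, unfolded
  have hsymp : ∀ w w' : (ι → K) × (ι → K), (Matrix.toLinearMap₂' K T) (G w).1 (G w').2 - (Matrix.toLinearMap₂' K T) (G w').1 (G w).2 = (Matrix.toLinearMap₂' K T) w.1 w'.2 - (Matrix.toLinearMap₂' K T) w'.1 w.2 := by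
    intro w w'
    have h := (mem_symplecticGroup _ _).1 g.2 w w'
    simpa only [polar_apply] using h
  -- the blocks
  let a₀ : (ι → K) →ₗ[K] (ι → K) := (LinearMap.fst K _ _) ∘ₗ G.toLinearMap ∘ₗ LinearMap.inl K _ _
  let c₀ : (ι → K) →ₗ[K] (ι → K) := (LinearMap.snd K _ _) ∘ₗ G.toLinearMap ∘ₗ LinearMap.inl K _ _
  let d₀ : (ι → K) →ₗ[K] (ι → K) := (LinearMap.snd K _ _) ∘ₗ G.toLinearMap ∘ₗ LinearMap.inr K _ _
  have hGx : ∀ x, G (x, 0) = (a₀ x, c₀ x) := fun x => rfl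
  have hGy : ∀ y, G (0, y) = (0, d₀ y) := fun y => Prod.ext (hg y) rfl
  -- `(Matrix.toLinearMap₂' K T)(a x, d y) = (Matrix.toLinearMap₂' K T)(x, y)` and `(Matrix.toLinearMap₂' K T)(a x, c x') = (Matrix.toLinearMap₂' K T)(a x', c x)`
  have had₀ : ∀ x y, (Matrix.toLinearMap₂' K T) (a₀ x) (d₀ y) = (Matrix.toLinearMap₂' K T) x y := by
    intro x y
    have h := hsymp (x, 0) (0, y)
    rw [hGx, hGy] at h
    simpa only [map_zero, LinearMap.zero_apply, sub_zero] using h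
  have hac : ∀ x x', (Matrix.toLinearMap₂' K T) (a₀ x) (c₀ x') = (Matrix.toLinearMap₂' K T) (a₀ x') (c₀ x) := by
    intro x x'
    have h := hsymp (x, 0) (x', 0)
    rw [hGx, hGx] at h
    simpa only [map_zero, sub_self, sub_eq_zero] using h
  -- `a₀`, `d₀` bijective
  have ha₀inj : Function.Injective a₀ := by
    rw [← LinearMap.ker_eq_bot, LinearMap.ker_eq_bot']
    intro x hx
    refine eq_zero_of_forall_left T hT fun y => ?_
    rw [← had₀, hx, map_zero, LinearMap.zero_apply]
  have hd₀inj : Function.Injective d₀ := by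
    rw [← LinearMap.ker_eq_bot, LinearMap.ker_eq_bot']
    intro y hy
    refine eq_zero_of_forall_right T hT fun x => ?_
    rw [← had₀, hy, map_zero]
  let a : (ι → K) ≃ₗ[K] (ι → K) := LinearEquiv.ofBijective a₀ ⟨ha₀inj, LinearMap.surjective_of_injective ha₀inj⟩
  let dd : (ι → K) ≃ₗ[K] (ι → K) := LinearEquiv.ofBijective d₀ ⟨hd₀inj, LinearMap.surjective_of_injective hd₀inj⟩
  have ha : ∀ x, a x = a₀ x := fun x => rfl
  have hdd : ∀ y, dd y = d₀ y := fun y => rfl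
  have had : ∀ x y, (Matrix.toLinearMap₂' K T) (a x) (dd y) = (Matrix.toLinearMap₂' K T) x y := fun x y => by rw [ha, hdd, had₀]
  -- the unipotent block `b = d⁻¹ c`
  let b : (ι → K) →ₗ[K] (ι → K) := (dd.symm : (ι → K) →ₗ[K] (ι → K)) ∘ₗ c₀
  have hddb : ∀ x, dd (b x) = c₀ x := fun x => dd.apply_symm_apply (c₀ x)
  have hβb : ∀ x x', (Matrix.toLinearMap₂' K T) x (b x') = (Matrix.toLinearMap₂' K T) (a₀ x) (c₀ x') := by
    intro x x'
    rw [← had₀ x (b x'), ← hdd, hddb]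
  have hbsymm : ∀ x x', (Matrix.toLinearMap₂' K T) x (b x') = (Matrix.toLinearMap₂' K T) x' (b x) := by
    intro x x'
    rw [hβb, hβb, hac]
  refine ⟨a, dd, had, b, hbsymm, ?_, fun x => rfl, fun y => rfl, fun x => (hddb x).symm⟩
  apply Subtype.ext
  refine LinearEquiv.ext fun w => ?_
  obtain ⟨x, y⟩ := w
  rw [Subgroup.coe_mul, LinearEquiv.mul_apply, coe_unipotentSp, unipotentσ_apply, coe_leviSp_apply]
  show G (x, y) = (a x, dd (y + b x))
  have e : ((x, y) : (ι → K) × (ι → K)) = (x, 0) + (0, y) := by simp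
  rw [e, map_add, hGx, hGy, map_add, hddb, ha, hdd, Prod.mk_add_mk, add_zero, add_comm (d₀ y)]

include hT in
/-- **pure unipotent case**: if `g` fixes `0 × Y` POINTWISE and is the identity on `X` modulo `Y` (`(g(x,0)).1 = x`), then `g = unipotentSp b` (`a = d = 1`).
[cite: Weil1964, n° 6, p. 151] -/
theorem exists_eq_unipotentSp (g : symplecticGroup (polar (Matrix.toLinearMap₂' K T)))
    (hg0 : ∀ y : ι → K, (g : ((ι → K) × (ι → K)) ≃ₗ[K] ((ι → K) × (ι → K))) (0, y) = (0, y))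
    (hg1 : ∀ x : ι → K, ((g : ((ι → K) × (ι → K)) ≃ₗ[K] ((ι → K) × (ι → K))) (x, 0)).1 = x) :
    ∃ (b : (ι → K) →ₗ[K] (ι → K)) (hb : ∀ x x' : ι → K, Matrix.toLinearMap₂' K T x (b x') = Matrix.toLinearMap₂' K T x' (b x)),
      g = unipotentSp _ b hb ∧ ∀ x, ((g : ((ι → K) × (ι → K)) ≃ₗ[K] ((ι → K) × (ι → K))) (x, 0)).2 = b x := by
  obtain ⟨a, d, had, b, hb, hg, ha, hd, hc⟩ := exists_eq_leviSp_mul_unipotentSp T hT g fun y => by rw [hg0]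
  have ha1 : a = LinearEquiv.refl K (ι → K) := LinearEquiv.ext fun x => by rw [← ha, hg1]; rfl
  have hd1 : d = LinearEquiv.refl K (ι → K) := LinearEquiv.ext fun y => by rw [← hd, hg0]; rfl
  subst ha1 hd1
  have h1 : leviSp (Matrix.toLinearMap₂' K T) (LinearEquiv.refl K (ι → K)) (LinearEquiv.refl K (ι → K)) had = 1 := by
    apply Subtype.ext
    refine LinearEquiv.ext fun w => ?_
    rw [coe_leviSp_apply]
    rfl
  refine ⟨b, hb, ?_, fun x => by rw [hc]; rfl⟩
  rw [hg, h1, one_mul]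

include hT in
/-- **pure Levi case**: if moreover `(g(x,0)).2 = 0` (`g` preserves `X × 0` as well), then `g = leviSp a d` (`b = 0`). [cite: Weil1964, n° 6, p. 151] -/
theorem exists_eq_leviSp (g : symplecticGroup (polar (Matrix.toLinearMap₂' K T)))
    (hg : ∀ y : ι → K, ((g : ((ι → K) × (ι → K)) ≃ₗ[K] ((ι → K) × (ι → K))) (0, y)).1 = 0)
    (hg' : ∀ x : ι → K, ((g : ((ι → K) × (ι → K)) ≃ₗ[K] ((ι → K) × (ι → K))) (x, 0)).2 = 0) :
    ∃ (a d : (ι → K) ≃ₗ[K] (ι → K)) (had : ∀ x y : ι → K, Matrix.toLinearMap₂' K T (a x) (d y) = Matrix.toLinearMap₂' K T x y),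
      g = leviSp _ a d had ∧
        (∀ x, ((g : ((ι → K) × (ι → K)) ≃ₗ[K] ((ι → K) × (ι → K))) (x, 0)).1 = a x) ∧
        (∀ y, ((g : ((ι → K) × (ι → K)) ≃ₗ[K] ((ι → K) × (ι → K))) (0, y)).2 = d y) := by
  obtain ⟨a, d, had, b, hb, hgeq, ha, hd, hc⟩ := exists_eq_leviSp_mul_unipotentSp T hT g hg
  have hb0 : b = 0 := by
    refine LinearMap.ext fun x => d.injective ?_
    rw [← hc, hg', LinearMap.zero_apply, map_zero]
  subst hb0
  have h1 : unipotentSp (Matrix.toLinearMap₂' K T) (0 : (ι → K) →ₗ[K] (ι → K)) hb = 1 := by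
    apply Subtype.ext
    refine LinearEquiv.ext fun w => ?_
    rw [coe_unipotentSp, unipotentσ_apply, LinearMap.zero_apply, add_zero]
    rfl
  refine ⟨a, d, had, ?_, ha, hd⟩
  rw [hgeq, h1, mul_one]

end SpDecomposition

/-! ## §2 `ℓ_Δ` is `deltaCoords⁻¹(0 × Y_Δ)` -/

section DeltaCoordinates

variable (F : Type) [Field F] [NumberField F] (v : HeightOneSpectrum (𝓞 F)) (n : ℕ)

/-- `deltaCoords⁻¹ (0, y) = deltaW (y_L) (y_R)`. [cite: Kudla1994, §2] -/
theorem deltaCoords_symm_inr (y : Fin (n + n) → v.adicCompletion F) :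
    (deltaCoords (K := v.adicCompletion F) (e₂ n)).symm (0, y) = deltaW (e₂ n) (resL (e₂ n) y) (resR (e₂ n) y) := by
  rw [LinearEquiv.symm_apply_eq, deltaCoords_deltaW, glue_resL_resR]

/-- **`ℓ_Δ = {w | (deltaCoords w).1 = 0}`** — the diagonal Lagrangian is the `Y_Δ`-axis of the `ℓ_Δ`-adapted coordinates. [cite: Kudla1994, §2] [cite: HarrisKudlaSweet1996, §1 (1.11)] -/
theorem mem_deltaLagrangian_iff_fst_deltaCoords (p : (Fin (n + n) → v.adicCompletion F) × (Fin (n + n) → v.adicCompletion F)) :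
    p ∈ deltaLagrangian F v n ↔ (deltaCoords (K := v.adicCompletion F) (e₂ n) p).1 = 0 := by
  constructor
  · intro hp
    have h1 : resR (e₂ n) p.1 = resL (e₂ n) p.1 := funext fun i => ((hp i).1).symm
    have h2 : resR (e₂ n) p.2 = resL (e₂ n) p.2 := funext fun i => ((hp i).2).symm
    have hpe : p = deltaW (e₂ n) (resL (e₂ n) p.1) (resL (e₂ n) p.2) := by
      refine Prod.ext ?_ ?_
      · show p.1 = glue (e₂ n) (resL (e₂ n) p.1) (resL (e₂ n) p.1)
        conv_lhs => rw [← glue_resL_resR (e₂ n) p.1, h1]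
      · show p.2 = glue (e₂ n) (resL (e₂ n) p.2) (resL (e₂ n) p.2)
        conv_lhs => rw [← glue_resL_resR (e₂ n) p.2, h2]
    rw [hpe, deltaCoords_deltaW]
  · intro h0
    have hpe : p = (deltaCoords (K := v.adicCompletion F) (e₂ n)).symm (0, (deltaCoords (K := v.adicCompletion F) (e₂ n) p).2) := by
      rw [LinearEquiv.eq_symm_apply]
      exact Prod.ext h0 rfl
    rw [hpe, deltaCoords_symm_inr]
    exact K2LiuDoublingEigenfunctionalNonvanishing.deltaW_mem_deltaLagrangian F v n _ _

end DeltaCoordinates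

/-! ## §3 The Siegel letters in the `ℓ_Δ`-adapted coordinates -/

section Letters

variable (F : Type) [Field F] [NumberField F] (E : Type) [Field E] [NumberField E] [Algebra F E]
  [Algebra.IsQuadraticExtension F E] (c : E ≃ₐ[F] E)
  {δ : E} (hcδ : c δ = -δ) (hδ : δ ≠ 0) {d : F} (hd : δ * δ = algebraMap F E d)
  (v : HeightOneSpectrum (𝓞 F)) (n : ℕ) {T₀ : Matrix (Fin n) (Fin n) F} (hT₀ : T₀.IsSymm) (hT₀d : IsUnit T₀.det)
  {JD : Matrix (Fin (n + n)) (Fin (n + n)) E} (hJD : JD = (gramD F n T₀).map (algebraMap F E))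

include hT₀d in
/-- `det T₀,v` is a unit. [folklore] -/
theorem isUnit_det_map_local : IsUnit (T₀.map (algebraMap F (v.adicCompletion F))).det := by
  rw [← RingHom.mapMatrix_apply, ← RingHom.map_det]
  exact hT₀d.map _

/-- **(P) THE PARABOLIC LETTER preserves the modulation Lagrangian**: for `h ∈ P_Δ(F_v)` (`IsSiegelDelta h`: `ι(h) ℓ_Δ = ℓ_Δ`), the transported element
`σ′ = deltaCoords ∘ ι(h) ∘ deltaCoords⁻¹` of `Sp(polar β_{J_Δ})` satisfies `(σ′(0, y)).1 = 0` — because `ℓ_Δ = deltaCoords⁻¹(0 × Y_Δ)` (§2).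
[cite: Kudla1994, §2, §3] [cite: MoeglinVignerasWaldspurger1987, Chap. 2 I.7] -/
theorem fst_deltaTransport_iotaD_inr (h : UnitaryGroup.localPi E c (n + n) JD v) (hh : IsSiegelDelta F E c hcδ hδ hd v n hT₀ hJD h)
    (y : Fin (n + n) → v.adicCompletion F) :
    (((deltaSymplecticTransport (e₂ n) (T₀.map (algebraMap F (v.adicCompletion F)))
          (localGram_gramD F v n (T₀ := T₀)) (iotaD F E c hcδ hδ hd v n hT₀ hJD h) :
          symplecticGroup (polar (Matrix.toLinearMap₂' (v.adicCompletion F)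
            (deltaGram (e₂ n) (T₀.map (algebraMap F (v.adicCompletion F))))))) :
        ((Fin (n + n) → v.adicCompletion F) × (Fin (n + n) → v.adicCompletion F)) ≃ₗ[v.adicCompletion F]
          ((Fin (n + n) → v.adicCompletion F) × (Fin (n + n) → v.adicCompletion F))) (0, y)).1 = 0 := by
  rw [deltaSymplecticTransport_apply]
  have hw : (deltaCoords (K := v.adicCompletion F) (e₂ n)).symm (0, y) ∈ deltaLagrangian F v n := by
    rw [deltaCoords_symm_inr]
    exact K2LiuDoublingEigenfunctionalNonvanishing.deltaW_mem_deltaLagrangian F v n _ _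
  have hle := (isSiegelDelta_iff_map_le F E c hcδ hδ hd v n hT₀ hJD h).1 hh
  exact (mem_deltaLagrangian_iff_fst_deltaCoords F v n _).1 (hle (Submodule.mem_map_of_mem hw))

include hT₀d in
/-- **(P) THE PARABOLIC LETTER IS `m(a, d) · n(b)`**: for `h ∈ P_Δ(F_v)`, `deltaCoords ∘ ι(h) ∘ deltaCoords⁻¹ = leviSp a d · unipotentSp b` in `Sp(polar β_{J_Δ})`
with `a x = (σ′(x,0)).1` (the action on `X_Δ ≅ 𝕎∕ℓ_Δ`), `d y = (σ′(0,y)).2` (the action on `Y_Δ ≅ ℓ_Δ`), `d (b x) = (σ′(x,0)).2`.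
[cite: Weil1964, n° 6, p. 151] [cite: Kudla1994, §3] -/
theorem exists_deltaTransport_iotaD_eq_leviSp_mul_unipotentSp (h : UnitaryGroup.localPi E c (n + n) JD v)
    (hh : IsSiegelDelta F E c hcδ hδ hd v n hT₀ hJD h) :
    ∃ (a d : (Fin (n + n) → v.adicCompletion F) ≃ₗ[v.adicCompletion F] (Fin (n + n) → v.adicCompletion F))
      (had : ∀ x y : Fin (n + n) → v.adicCompletion F,
        Matrix.toLinearMap₂' (v.adicCompletion F) (deltaGram (e₂ n) (T₀.map (algebraMap F (v.adicCompletion F)))) (a x) (d y) =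
          Matrix.toLinearMap₂' (v.adicCompletion F) (deltaGram (e₂ n) (T₀.map (algebraMap F (v.adicCompletion F)))) x y)
      (b : (Fin (n + n) → v.adicCompletion F) →ₗ[v.adicCompletion F] (Fin (n + n) → v.adicCompletion F))
      (hb : ∀ x x' : Fin (n + n) → v.adicCompletion F,
        Matrix.toLinearMap₂' (v.adicCompletion F) (deltaGram (e₂ n) (T₀.map (algebraMap F (v.adicCompletion F)))) x (b x') =
          Matrix.toLinearMap₂' (v.adicCompletion F) (deltaGram (e₂ n) (T₀.map (algebraMap F (v.adicCompletion F)))) x' (b x)),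
      deltaSymplecticTransport (e₂ n) (T₀.map (algebraMap F (v.adicCompletion F)))
          (localGram_gramD F v n (T₀ := T₀)) (iotaD F E c hcδ hδ hd v n hT₀ hJD h) =
        leviSp _ a d had * unipotentSp _ b hb := by
  obtain ⟨a, d', had, b, hb, heq, -, -, -⟩ := exists_eq_leviSp_mul_unipotentSp
    (deltaGram (e₂ n) (T₀.map (algebraMap F (v.adicCompletion F))))
    (isUnit_det_deltaGram (e₂ n) _ (isUnit_det_map_local F v n hT₀d)) _
    (fst_deltaTransport_iotaD_inr F E c hcδ hδ hd v n hT₀ hJD h hh)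
  exact ⟨a, d', had, b, hb, heq⟩

include hT₀d in
/-- **(N) THE UNIPOTENT LETTER IS A PURE `n(b)`**: an ADAPTED Siegel unipotent `u` (`adapt (matA u) = (1, t; 0, 1)` — ★ `iotaD_apply_of_mem_deltaLagrangian`: `ι(u)` fixes
`ℓ_Δ` pointwise; ★ `iotaD_apply_sub_mem_deltaLagrangian`: `ι(u) ≡ 1 mod ℓ_Δ`) goes to `unipotentSp b` in the `ℓ_Δ`-adapted coordinates (`a = d = 1`): in the doubling-polarised
model `N_Δ` acts by second-degree characters only. [cite: Kudla1994, §3 Thm. 3.1] [cite: Weil1964, n° 6, n° 13] -/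
theorem exists_deltaTransport_iotaD_eq_unipotentSp (u : UnitaryGroup.localPi E c (n + n) JD v) (t : Matrix (Fin n) (Fin n) (LocalRing E v))
    (hu : adapt (matA F E c v n u) = Matrix.fromBlocks 1 t 0 1) :
    ∃ (b : (Fin (n + n) → v.adicCompletion F) →ₗ[v.adicCompletion F] (Fin (n + n) → v.adicCompletion F))
      (hb : ∀ x x' : Fin (n + n) → v.adicCompletion F,
        Matrix.toLinearMap₂' (v.adicCompletion F) (deltaGram (e₂ n) (T₀.map (algebraMap F (v.adicCompletion F)))) x (b x') =
          Matrix.toLinearMap₂' (v.adicCompletion F) (deltaGram (e₂ n) (T₀.map (algebraMap F (v.adicCompletion F)))) x' (b x)),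
      deltaSymplecticTransport (e₂ n) (T₀.map (algebraMap F (v.adicCompletion F)))
          (localGram_gramD F v n (T₀ := T₀)) (iotaD F E c hcδ hδ hd v n hT₀ hJD u) = unipotentSp _ b hb := by
  set σ' := deltaSymplecticTransport (e₂ n) (T₀.map (algebraMap F (v.adicCompletion F)))
      (localGram_gramD F v n (T₀ := T₀)) (iotaD F E c hcδ hδ hd v n hT₀ hJD u) with hσ'
  -- `ι(u)` fixes `ℓ_Δ ∋ deltaCoords⁻¹ (0, y)` pointwise
  have hy : ∀ y : Fin (n + n) → v.adicCompletion F,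
      (σ' : ((Fin (n + n) → v.adicCompletion F) × (Fin (n + n) → v.adicCompletion F)) ≃ₗ[v.adicCompletion F]
        ((Fin (n + n) → v.adicCompletion F) × (Fin (n + n) → v.adicCompletion F))) (0, y) = (0, y) := by
    intro y
    rw [hσ', deltaSymplecticTransport_apply]
    have hw : (deltaCoords (K := v.adicCompletion F) (e₂ n)).symm (0, y) ∈ deltaLagrangian F v n := by
      rw [deltaCoords_symm_inr]
      exact K2LiuDoublingEigenfunctionalNonvanishing.deltaW_mem_deltaLagrangian F v n _ _
    have h1 := iotaD_apply_of_mem_deltaLagrangian F E c hcδ hδ hd v n hT₀ hJD u t hu hw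
    rw [show (iotaD F E c hcδ hδ hd v n hT₀ hJD u).1 ((deltaCoords (K := v.adicCompletion F) (e₂ n)).symm (0, y)) =
        toLin F v (iotaD F E c hcδ hδ hd v n hT₀ hJD u) ((deltaCoords (K := v.adicCompletion F) (e₂ n)).symm (0, y)) from rfl,
      h1, LinearEquiv.apply_symm_apply]
  -- `ι(u) ≡ 1 mod ℓ_Δ`
  have hx : ∀ x : Fin (n + n) → v.adicCompletion F,
      ((σ' : ((Fin (n + n) → v.adicCompletion F) × (Fin (n + n) → v.adicCompletion F)) ≃ₗ[v.adicCompletion F]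
        ((Fin (n + n) → v.adicCompletion F) × (Fin (n + n) → v.adicCompletion F))) (x, 0)).1 = x := by
    intro x
    rw [hσ', deltaSymplecticTransport_apply]
    have h1 := (mem_deltaLagrangian_iff_fst_deltaCoords F v n _).1
      (iotaD_apply_sub_mem_deltaLagrangian F E c hcδ hδ hd v n hT₀ hJD u t hu ((deltaCoords (K := v.adicCompletion F) (e₂ n)).symm (x, 0)))
    rw [map_sub, Prod.fst_sub, sub_eq_zero, LinearEquiv.apply_symm_apply] at h1
    exact h1
  obtain ⟨b, hb, heq, -⟩ := exists_eq_unipotentSp (deltaGram (e₂ n) (T₀.map (algebraMap F (v.adicCompletion F))))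
    (isUnit_det_deltaGram (e₂ n) _ (isUnit_det_map_local F v n hT₀d)) σ' hy hx
  exact ⟨b, hb, heq⟩

end Letters

end Summit.HodgeConjecture.HodgeConjecture.Cruxes.HLiu418.K2LiuDeltaSpTransportSiegelLetters

end
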